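import Summits.NavierStokesRegularity.FluidComputer.GateBudgetSecondPulse
import Summits.NavierStokesRegularity.FluidComputer.GateBudgetDrainReset
import HarnessLib

/-!
# What no tuning can beat, part 44: AFTER ITS SECOND PULSE A LATTICE DUD IS QUIET AGAIN — the
# trigger is cold for `2θ` after ANY dousing with `b ≤ -θε` (`θ ≤ 1.4141`); the second dousing
# opens a second cold window (`1.3998` from the clock radius, `1/2` with the misfire numbers)
# on which the output pair stays `≤ 1/40 + 1/K⁹` and the drain re-empties the transfer mode

Cell `pub-fluidc`, blueprint seat bp1 (gen 33, fourth item); same namespace and conventions as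
parts 1–43 (`GateBudget*.lean`); imports part 42 (`GateBudgetSecondPulse`: the second pulse of
a lattice dud misfires, and through it part 41 `GateBudgetSecondIgnition`, 38
`GateBudgetSharpRefire`, 31 `GateBudgetClockDebt`) and part 43 (`GateBudgetDrainReset`: the
drain empties the transfer mode under a capped trigger, and through it part 40
`GateBudgetColdOutput`). Modes `0 = a` carrier, `1 = b` clock, `2 = c` trigger, `3 = d`
transfer, `4 = ã` output; `t₋ = √(2 - 24 log K/K¹⁰)`, `t₊ = √(2 + 2/K¹⁰) + 242/K⁹`.
HONEST FRAMING (verbatim): low prior, high value-of-information experiment on Tao's machine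
paradigm; NOT a claim that NS blows up.

THE SYSTEM. The rotor-gate `K`-family `rotorCircuit K M ε ρ` of Theorem 5.3 / (5.6) at the
headline coupling `M = K¹⁰` (`μ = ε⁻¹K¹⁰`, `σ = ρ²e^{-K¹⁰}`), from `delayInit`, on the tuning
window `200ε/K²⁰ ≤ ρ² ≤ 2ε/K¹⁰`, `ε² ≤ 1/(6K²⁰)`, `K ≥ 16`; a LATTICE DUD is a member with
`ε = k·K¹⁰ρ²` (`k ∈ ℕ`): its first pulse misfires (part 22), its clock is doused at `T ∈ [t₋,
t₊]`, the trigger stays cold for `2.8282`, re-lights at `r₁ ∈ (t₋ + 2.8282, t₊ + 2.8542)`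
(part 38), the second pulse lasts `≤ 242/K⁹` and is doused at `T₂` with `b(T₂) ≤ -ε/4`,
`c(T₂) ≤ 2ρ²/K¹⁰` (part 41), and misfires: `d(T₂)² + ã(T₂)² ≤ 1/40` (part 42).

THE STATEMENTS. §131 `knob_cold_of_doused_clock` — COLD FOR `2θ` AFTER ANY DOUSING: at any
time `T ≥ 0` with `b(T) ≤ -θε` (`θ ≤ 1.4141`) and `c(T) ≤ 2ρ²/K¹⁰`, `c < ρ²/K⁹` on `[T, T +
2θ]` (every member of the window; part 38's §112 is the case `θ = 1.4141`). §132
`knob_dud_second_cold` — THE SECOND COLD WINDOW OF A LATTICE DUD: part 41's times `r₁ < T₂`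
with all twelve of its facts, AND: the doused clock `b(T₂) ≤ -0.6999ε` (from part 41's clock
radius `(7ε/10)² ≤ b² + c²` on the pulse and `c(T₂) ≤ ε/100`), the cold trigger `c < ρ²/K⁹`
on `[T₂, T₂ + 1.3998]`, and there, for `t > T₂`, the drain law of part 43: `d(t)² ≤ 1/(K²(t -
T₂)²) + 3/K⁹` and `ã(t)² ≥ d(T₂)² + ã(T₂)² - 1/(K²(t - T₂)²) - 5/K⁹`. §133
`knob_dud_quiet_again` — QUIET AGAIN, WITH THE MISFIRE NUMBERS: part 42's times `r₁ < T₂` with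
all twelve of its facts (phase pinned to `kπ ± 0.07`, `d(T₂)² + ã(T₂)² ≤ 1/40`, `a(T₂)² ≥ 39/40
- 10⁻⁵`), AND on `[T₂, T₂ + 1/2]`: `c < ρ²/K⁹`, `d² + ã² ≤ 1/40 + 1/K⁹`, `a² ≥ 39/40 -
2·10⁻⁵`, and for `t > T₂`, `d(t)² ≤ 1/(K²(t - T₂)²) + 1/K⁹`.

HOW. §131 is part 31's clock-debt trigger law `c(t) ≤ e^{μ(t - T)(ε(t - T)/2 - θε)}(c(T) +
σe^{μθ²ε/2}(t - T))` read on `t - T ≤ 2θ`, where the exponent is `≤ 0`, with the seed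
`σe^{μθ²ε/2} = ρ²e^{-(1 - θ²/2)K¹⁰} ≤ ρ²e^{-(32119/2·10⁸)K¹⁰} ≤ ρ²/(5000K¹⁰)` (`θ² ≤
1.4141²`, part 38's `sharp_facts`) and `2/K¹⁰ + 2.8282/(5000K¹⁰) < 1/K⁹`. §132: `b(T₂)² ≥
0.49ε² - c(T₂)² ≥ (0.6999ε)²` and `b(T₂) ≤ -ε/4 < 0`; §131 at `θ = 0.6999`; part 43's
`knob_drain_empties_transfer` on `[T₂, T₂ + 1.3998]` with `c₁ = ρ²/K⁹` (`2(c₁/ρ²)H ≤ 3/K⁹`,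
`3(c₁/ρ²)H ≤ 5/K⁹`). §133: §131 at `θ = 1/4`; part 40's `knob_output_frozen` (`|d² + ã² -
(d(T₂)² + ã(T₂)²)| ≤ (t - T₂)/K⁹ ≤ 1/(2K⁹)`); part 43's drain law with `H = 1/2` (`2(c₁/ρ²)H
= 1/K⁹`); the energy identity with `|b(t)| ≤ (ε + σ)t ≤ 10ε` (`t ≤ 5`), `c ≤ ρ²/K⁹ ≤ ε`,
`101ε² ≤ 10⁻⁵`.

READING. Two pulses in, a lattice dud's state is its state after one pulse up to `1/40`: the
trigger is cold again, the output pair is frozen at what the two misfires leaked (`≤ 1/40 +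
1/K⁹`), the carrier still holds `≥ 39/40 - 2·10⁻⁵` of the energy, and within the cold window
the transfer mode is re-emptied to `d² ≤ 1/(K²(t - T₂)²) + O(K⁻⁹)` — the entry data of a third
pulse are those of the second except for the clock. §131 makes the cold window a function of
ONE number, the doused clock `-b(T)/ε`: `2.8282` after the first dousing (`b(T) ≈ -√2ε`, parts
29–31), provably `1.3998` after the second (`|b(T₂)| ≥ 0.6999ε` is all part 41's radius gives).

HONEST LIMITS. (i) The true second cold window is again `≈ 2√2` (`b(T₂) ≈ -√2ε`: the pulse
conserves `b² + c² ≈ 2ε²` to leading order); proving it needs a two-sided sharp clock at `T₂`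
(the analogue of parts 29–31 re-based at the second pulse), which this file does not supply —
hence no third ignition time and no induction over pulses yet; (ii) §133's window `1/2` is what
part 42's exported `b(T₂) ≤ -ε/4` buys; §132's `1.3998` comes without the misfire numbers
because parts 41 and 42 export different witness tuples (no cross-theorem identification is
claimed); (iii) lattice duds only (`ε = k·K¹⁰ρ²`); generic members fire partially and are not
treated; (iv) `M = K¹⁰`, `K ≥ 16`, `200ε/K²⁰ ≤ ρ² ≤ 2ε/K¹⁰`, `ε² ≤ 1/(6K²⁰)` throughout (§131
needs only `K ≥ 16`, `0 < ε`, `0 < ρ`); (v) nothing about Navier–Stokes.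
[cite: Tao2016AveragedNS, §5.5 Theorem 5.3, (5.5), (5.6), (b-eq), (c-eq), (energy-con)]
-/

noncomputable section

namespace Summit.NavierStokesRegularity.FluidComputer.GateBudget

open Real Set Filter Topology
open Literature.Analysis.FluidPDE.Tao2016AveragedNS

variable {K ε ρ : ℝ} {X : ℝ → Fin 5 → ℝ} {C : ℝ → ℝ}

/-! ## §131 The trigger is cold for `2θ` after any dousing with `b ≤ -θε` -/

/-- **COLD FOR `2θ` AFTER ANY DOUSING.** At `M = K¹⁰` (`K ≥ 16`, `0 < ε`, `0 < ρ`), along the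
exact trajectory of `rotorCircuit K K¹⁰ ε ρ` from (5.6): at any time `T ≥ 0` with `b(T) ≤ -θε`,
`θ ≤ 1.4141`, and `c(T) ≤ 2ρ²/K¹⁰`, the trigger stays cold, `c < ρ²/K⁹`, on `[T, T + 2θ]`.
Part 31's clock-debt trigger law at `β = θε`: the exponent `μ(t - T)(ε(t - T)/2 - θε)` is `≤ 0`
up to `t - T = 2θ`, the seed is `σe^{μθ²ε/2} = ρ²e^{-(1 - θ²/2)K¹⁰} ≤ ρ²e^{-(32119/2·10⁸)K¹⁰}
≤ ρ²/(5000K¹⁰)`, and `2/K¹⁰ + 2.8282/(5000K¹⁰) < 1/K⁹`. Part 38's §112 is `θ = 1.4141`.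
[cite: Tao2016AveragedNS, §5.5 Theorem 5.3, (b-eq), (c-eq), (energy-con)] -/
theorem knob_cold_of_doused_clock
    (hX : ∀ t, HasDerivAt X (RotorKnob.rotorCircuit K (K ^ 10) ε ρ (X t)) t)
    (h0 : X 0 = delayInit) (hK : 16 ≤ K) (hε : 0 < ε) (hρ : 0 < ρ) {T θ : ℝ} (hT0 : 0 ≤ T)
    (hθ : θ ≤ 14141 / 10000) (hbT : X T 1 ≤ -(θ * ε)) (hcT : X T 2 ≤ 2 * ρ ^ 2 / K ^ 10) :
    ∀ t ∈ Icc T (T + 2 * θ), X t 2 < ρ ^ 2 / K ^ 9 := by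
  intro t ht
  have hK0 : 0 < K := by linarith
  have hK10 : 0 < K ^ 10 := by positivity
  obtain ⟨-, -, -, hqp, -, -, -, hexp, -⟩ := sharp_facts hK
  have hXf := hX
  rw [RotorKnob.rotorCircuit_eq_fiveGate] at hXf
  have hσ0 : 0 ≤ ρ ^ 2 * exp (-K ^ 10) := by positivity
  have hμ0 : 0 ≤ ε⁻¹ * K ^ 10 := by positivity
  have ht0 : 0 ≤ t - T := by linarith only [ht.1]
  have hθ0 : 0 ≤ θ := by linarith only [ht.1, ht.2]
  have hlaw := debt_trigger_law hXf h0 hε hσ0 hμ0 hT0 hbT ht.1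
  -- the debt exponent is `≤ 0` on the window
  have hG : exp (ε⁻¹ * K ^ 10 * (t - T) * (ε * (t - T) / 2 - θ * ε)) ≤ 1 := by
    rw [Real.exp_le_one_iff]
    have h1 : ε * (t - T) ≤ ε * (2 * θ) :=
      mul_le_mul_of_nonneg_left (by linarith only [ht.2]) hε.le
    exact mul_nonpos_iff.2 (Or.inl ⟨mul_nonneg hμ0 ht0, by linarith only [h1]⟩)
  -- the seed `σe^{μθ²ε/2} = ρ²e^{-(1 - θ²/2)K¹⁰} ≤ ρ²e^{-(32119/2·10⁸)K¹⁰} ≤ ρ²/(5000K¹⁰)`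
  have hseed : ρ ^ 2 * exp (-K ^ 10) * exp (ε⁻¹ * K ^ 10 * (θ * ε) ^ 2 / (2 * ε))
      = ρ ^ 2 * exp (-((1 - θ ^ 2 / 2) * K ^ 10)) := by
    rw [mul_assoc, ← Real.exp_add]; congr 2; field_simp; ring
  have hexp' : exp (-((1 - θ ^ 2 / 2) * K ^ 10)) ≤ 1 / (5000 * K ^ 10) := by
    refine (Real.exp_le_exp.2 ?_).trans hexp
    have hθ2 : θ ^ 2 ≤ (14141 / 10000) ^ 2 := pow_le_pow_left₀ hθ0 hθ 2
    have h1 : (32119 / 200000000 : ℝ) * K ^ 10 ≤ (1 - θ ^ 2 / 2) * K ^ 10 :=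
      mul_le_mul_of_nonneg_right (by norm_num at hθ2 ⊢; linarith only [hθ2]) hK10.le
    linarith only [h1]
  have hc0 : 0 ≤ X T 2 := c_nonneg hXf h0 hσ0 hT0
  have h1 : X t 2 ≤ X T 2 + ρ ^ 2 * exp (-K ^ 10)
      * exp (ε⁻¹ * K ^ 10 * (θ * ε) ^ 2 / (2 * ε)) * (t - T) :=
    hlaw.trans (mul_le_of_le_one_left (add_nonneg hc0 (by positivity)) hG)
  rw [hseed] at h1
  have h2 : ρ ^ 2 * exp (-((1 - θ ^ 2 / 2) * K ^ 10)) * (t - T)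
      ≤ ρ ^ 2 * (1 / (5000 * K ^ 10)) * (28282 / 10000) :=
    mul_le_mul (mul_le_mul_of_nonneg_left hexp' (sq_nonneg ρ))
      (by linarith only [ht.1, ht.2, hθ]) ht0 (by positivity)
  have h3 : 2 * ρ ^ 2 / K ^ 10 + ρ ^ 2 * (1 / (5000 * K ^ 10)) * (28282 / 10000)
      < ρ ^ 2 / K ^ 9 := by
    rw [show 2 * ρ ^ 2 / K ^ 10 + ρ ^ 2 * (1 / (5000 * K ^ 10)) * (28282 / 10000)
        = ρ ^ 2 * ((2 + 28282 / 50000000) * (1 / K ^ 10)) by field_simp; ring,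
      show ρ ^ 2 / K ^ 9 = ρ ^ 2 * (1 / K ^ 9) by ring]
    exact mul_lt_mul_of_pos_left (by linarith only [hqp, hK10, one_div_pos.2 hK10])
      (by positivity)
  linarith only [h1, hcT, h2, h3]

/-! ## §132 The second cold window of a lattice dud (`1.3998`) and the drain on it -/

/-- **THE SECOND COLD WINDOW OF A LATTICE DUD.** At `M = K¹⁰` (`K ≥ 16`, `0 < ε`, `ε² ≤
1/(6K²⁰)`), along the exact trajectory of `rotorCircuit K K¹⁰ ε ρ` from (5.6), with any
primitive `C` of the trigger: every LATTICE member of the window (`200ε/K²⁰ ≤ ρ² ≤ 2ε/K¹⁰`, `ε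
= k·K¹⁰ρ²`) has times `r₁ < T₂` with ALL of part 41's facts — `r₁ ∈ (t₋ + 2.8282, t₊ +
2.8542)`, `T₂ - r₁ ≤ 242/K⁹`, `c > 0` and `(7ε/10)² ≤ b² + c²` on `[r₁, T₂]`, `b(r₁) ≥ 1.39ε`,
`c(r₁) = ρ²/K⁹`, `b(T₂) ≤ -ε/4`, `c(T₂) ≤ λ₀ρ²`, `a(r₁)² ≥ 0.993`, `ã(T₂) ≤ ã(r₁) + K(T₂ -
r₁)` — AND: THE DOUSED CLOCK `b(T₂) ≤ -0.6999ε`; THE COLD TRIGGER `c < ρ²/K⁹` on `[T₂, T₂ +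
1.3998]`; and for `t ∈ (T₂, T₂ + 1.3998]` THE DRAIN: `d(t)² ≤ 1/(K²(t - T₂)²) + 3/K⁹` and
`ã(t)² ≥ d(T₂)² + ã(T₂)² - 1/(K²(t - T₂)²) - 5/K⁹`. (Radius at `T₂` with `c(T₂) ≤ ε/100`;
§131 at `θ = 0.6999`; part 43's `knob_drain_empties_transfer` with `c₁ = ρ²/K⁹`, `H = 1.3998`.)
[cite: Tao2016AveragedNS, §5.5 Theorem 5.3, (5.5), (5.6), (b-eq), (c-eq), (dora), (tcable)] -/
theorem knob_dud_second_cold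
    (hX : ∀ t, HasDerivAt X (RotorKnob.rotorCircuit K (K ^ 10) ε ρ (X t)) t)
    (h0 : X 0 = delayInit) (hC : ∀ t, HasDerivAt C (X t 2) t) (hK : 16 ≤ K) (hε : 0 < ε)
    (hεK : ε ^ 2 ≤ 1 / (6 * K ^ 20)) (hρ : 0 < ρ) (hlo : 200 * ε / K ^ 20 ≤ ρ ^ 2)
    (hhi : K ^ 10 * ρ ^ 2 ≤ 2 * ε) (k : ℕ) (hk : ε = k * K ^ 10 * ρ ^ 2) :
    ∃ r₁ T₂ : ℝ, √(2 - 24 * Real.log K / K ^ 10) + 28282 / 10000 < r₁ ∧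
      r₁ < √(2 + 2 / K ^ 10) + 242 / K ^ 9 + 28542 / 10000 ∧ r₁ < T₂ ∧
      T₂ - r₁ ≤ 242 / K ^ 9 ∧
      (∀ t ∈ Icc r₁ T₂, 0 < X t 2) ∧
      (∀ t ∈ Icc r₁ T₂, (7 / 10 * ε) ^ 2 ≤ X t 1 ^ 2 + X t 2 ^ 2) ∧
      139 / 100 * ε ≤ X r₁ 1 ∧ X r₁ 2 = ρ ^ 2 / K ^ 9 ∧ X T₂ 1 ≤ -(ε / 4) ∧
      X T₂ 2 ≤ (1 / K ^ 10 + 4 * exp (-K ^ 10) / K ^ 10) * ρ ^ 2 ∧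
      993 / 1000 ≤ X r₁ 0 ^ 2 ∧ X T₂ 4 ≤ X r₁ 4 + K * (T₂ - r₁) ∧
      X T₂ 1 ≤ -(6999 / 10000 * ε) ∧
      (∀ t ∈ Icc T₂ (T₂ + 13998 / 10000), X t 2 < ρ ^ 2 / K ^ 9) ∧
      (∀ t ∈ Icc T₂ (T₂ + 13998 / 10000), T₂ < t →
        X t 3 ^ 2 ≤ 1 / (K ^ 2 * (t - T₂) ^ 2) + 3 / K ^ 9 ∧
        X T₂ 3 ^ 2 + X T₂ 4 ^ 2 - 1 / (K ^ 2 * (t - T₂) ^ 2) - 5 / K ^ 9 ≤ X t 4 ^ 2) := by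
  have hK0 : 0 < K := by linarith
  have hρ2 : 0 < ρ ^ 2 := by positivity
  obtain ⟨hq1, -, -, -, -, -, hρε, -⟩ := refire_window_facts hK hε hεK hhi
  obtain ⟨-, -, hlam2, -⟩ := cold_facts hK hε
  obtain ⟨r₁, T₂, hr1, hr2, hsT, hτ, hc, hr, hb139, hcr₁, hbT, hcT, ha1, hgrow⟩ :=
    knob_dud_second_ignition hX h0 hC hK hε hεK hρ hlo hhi k hk
  have hr₁0 : 0 ≤ r₁ := by linarith [Real.sqrt_nonneg (2 - 24 * Real.log K / K ^ 10)]
  have hT0 : 0 ≤ T₂ := by linarith only [hr₁0, hsT]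
  have hcT2 : X T₂ 2 ≤ 2 * ρ ^ 2 / K ^ 10 := by
    rw [show 2 * ρ ^ 2 / K ^ 10 = 2 * (1 / K ^ 10) * ρ ^ 2 by ring]
    exact hcT.trans (mul_le_mul_of_nonneg_right hlam2 hρ2.le)
  -- the doused clock from the radius: `b² ≥ 0.49ε² - c² ≥ (0.6999ε)²`, `b ≤ -ε/4 < 0`
  have hbT2 : X T₂ 1 ≤ -(6999 / 10000 * ε) := by
    have hrad := hr T₂ ⟨hsT.le, le_rfl⟩
    have hc1 : X T₂ 2 ≤ ε / 100 := by
      have h1 : 2 * (1 / K ^ 10) * ρ ^ 2 ≤ 2 * (1 / 1099511627776) * ε :=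
        mul_le_mul (mul_le_mul_of_nonneg_left hq1 (by norm_num)) hρε hρ2.le (by norm_num)
      linarith only [hcT2, h1, hε, show 2 * ρ ^ 2 / K ^ 10 = 2 * (1 / K ^ 10) * ρ ^ 2 by ring]
    have hc2 : X T₂ 2 ^ 2 ≤ (ε / 100) ^ 2 :=
      pow_le_pow_left₀ (hc T₂ ⟨hsT.le, le_rfl⟩).le hc1 2
    by_contra hb
    rw [not_le] at hb
    have h3 := mul_pos (by linarith only [hb] : 0 < 6999 / 10000 * ε + X T₂ 1)
      (by linarith only [hbT, hε] : 0 < 6999 / 10000 * ε - X T₂ 1)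
    nlinarith [hrad, hc2, h3, sq_nonneg ε]
  -- the cold window: §131 at `θ = 0.6999`
  have hcold : ∀ t ∈ Icc T₂ (T₂ + 13998 / 10000), X t 2 < ρ ^ 2 / K ^ 9 := by
    have h := knob_cold_of_doused_clock hX h0 hK hε hρ hT0 (θ := 6999 / 10000) (by norm_num)
      hbT2 hcT2
    intro t ht
    exact h t ⟨ht.1, by linarith only [ht.2]⟩
  have hc' : ∀ r ∈ Icc T₂ (T₂ + 13998 / 10000), X r 2 ≤ ρ ^ 2 / K ^ 9 :=
    fun r hr => (hcold r hr).le
  have hu1 : ρ ^ 2 / K ^ 9 / ρ ^ 2 = 1 / K ^ 9 := by field_simp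
  have hK9 : 0 < 1 / K ^ 9 := by positivity
  refine ⟨r₁, T₂, hr1, hr2, hsT, hτ, hc, hr, hb139, hcr₁, hbT, hcT, ha1, hgrow, hbT2, hcold,
    ?_⟩
  intro t ht hTt
  have h := knob_drain_empties_transfer hX h0 hK0 hρ hT0 (by positivity) hc' ht hTt
  rw [hu1] at h
  constructor
  · rw [show (3 : ℝ) / K ^ 9 = 3 * (1 / K ^ 9) by ring]
    linarith only [h.1, hK9]
  · rw [show (5 : ℝ) / K ^ 9 = 5 * (1 / K ^ 9) by ring]
    linarith only [h.2, hK9]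

/-! ## §133 Quiet again: the misfire numbers on `[T₂, T₂ + 1/2]` -/

/-- **AFTER ITS SECOND PULSE A LATTICE DUD IS QUIET AGAIN.** At `M = K¹⁰` (`K ≥ 16`, `0 < ε`,
`ε² ≤ 1/(6K²⁰)`), along the exact trajectory of `rotorCircuit K K¹⁰ ε ρ` from (5.6), with any
primitive `C` of the trigger: every LATTICE member of the window (`200ε/K²⁰ ≤ ρ² ≤ 2ε/K¹⁰`, `ε
= k·K¹⁰ρ²`) has times `r₁ < T₂` with ALL of part 42's facts — `r₁ ∈ (t₋ + 2.8282, t₊ +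
2.8542)`, `T₂ - r₁ ≤ 242/K⁹`, `c(r₁) = ρ²/K⁹`, `a(r₁)² ≥ 0.993`, `b(T₂) ≤ -ε/4`, `c(T₂) ≤
2ρ²/K¹⁰`, the phase pin `|(C(T₂) - C(r₁))/ρ² - kπ| ≤ 0.07`, `|d(T₂)| ≤ 0.07|a(r₁)| + |d(r₁)| +
10⁻⁶`, `d(T₂)² + ã(T₂)² ≤ 1/40`, `a(T₂)² ≥ 39/40 - 10⁻⁵` — AND on `[T₂, T₂ + 1/2]`: THE COLD
TRIGGER `c < ρ²/K⁹`, THE FROZEN OUTPUT PAIR `d² + ã² ≤ 1/40 + 1/K⁹`, THE CARRIER `a² ≥ 39/40 -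
2·10⁻⁵`; and for `t ∈ (T₂, T₂ + 1/2]` THE DRAIN `d(t)² ≤ 1/(K²(t - T₂)²) + 1/K⁹`. (§131 at `θ
= 1/4`; part 40's `knob_output_frozen` and part 43's `knob_drain_empties_transfer` with `c₁ =
ρ²/K⁹`, `H = 1/2`; energy with `|b(t)| ≤ (ε + σ)t ≤ 10ε`, `c ≤ ε`, `101ε² ≤ 10⁻⁵`.)
[cite: Tao2016AveragedNS, §5.5 Theorem 5.3, (5.5), (5.6), (b-eq), (c-eq), (energy-con)] -/
theorem knob_dud_quiet_again
    (hX : ∀ t, HasDerivAt X (RotorKnob.rotorCircuit K (K ^ 10) ε ρ (X t)) t)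
    (h0 : X 0 = delayInit) (hC : ∀ t, HasDerivAt C (X t 2) t) (hK : 16 ≤ K) (hε : 0 < ε)
    (hεK : ε ^ 2 ≤ 1 / (6 * K ^ 20)) (hρ : 0 < ρ) (hlo : 200 * ε / K ^ 20 ≤ ρ ^ 2)
    (hhi : K ^ 10 * ρ ^ 2 ≤ 2 * ε) (k : ℕ) (hk : ε = k * K ^ 10 * ρ ^ 2) :
    ∃ r₁ T₂ : ℝ, √(2 - 24 * Real.log K / K ^ 10) + 28282 / 10000 < r₁ ∧
      r₁ < √(2 + 2 / K ^ 10) + 242 / K ^ 9 + 28542 / 10000 ∧ r₁ < T₂ ∧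
      T₂ - r₁ ≤ 242 / K ^ 9 ∧ X r₁ 2 = ρ ^ 2 / K ^ 9 ∧ 993 / 1000 ≤ X r₁ 0 ^ 2 ∧
      X T₂ 1 ≤ -(ε / 4) ∧ X T₂ 2 ≤ 2 * ρ ^ 2 / K ^ 10 ∧
      |(C T₂ - C r₁) / ρ ^ 2 - k * π| ≤ 7 / 100 ∧
      |X T₂ 3| ≤ 7 / 100 * |X r₁ 0| + |X r₁ 3| + 1 / 10 ^ 6 ∧
      X T₂ 3 ^ 2 + X T₂ 4 ^ 2 ≤ 1 / 40 ∧ 39 / 40 - 1 / 10 ^ 5 ≤ X T₂ 0 ^ 2 ∧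
      (∀ t ∈ Icc T₂ (T₂ + 1 / 2), X t 2 < ρ ^ 2 / K ^ 9 ∧
        X t 3 ^ 2 + X t 4 ^ 2 ≤ 1 / 40 + 1 / K ^ 9 ∧ 39 / 40 - 2 / 10 ^ 5 ≤ X t 0 ^ 2) ∧
      (∀ t ∈ Icc T₂ (T₂ + 1 / 2), T₂ < t →
        X t 3 ^ 2 ≤ 1 / (K ^ 2 * (t - T₂) ^ 2) + 1 / K ^ 9) := by
  have hK0 : 0 < K := by linarith
  have hK10 : 0 < K ^ 10 := by positivity
  have hρ2 : 0 < ρ ^ 2 := by positivity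
  have h9 : (68719476736 : ℝ) ≤ K ^ 9 := by
    have := headline_pow_floor hK 9; norm_num at this; exact this
  have h10 : (1099511627776 : ℝ) ≤ K ^ 10 := by
    have := headline_pow_floor hK 10; norm_num at this; exact this
  obtain ⟨hq1, -, -, -, -, -, hρε, -, -, -, hσ, -⟩ := refire_window_facts hK hε hεK hhi
  obtain ⟨-, -, -, -, -, -, hsq2, -, -⟩ := sharp_facts hK
  have hXf := hX
  rw [RotorKnob.rotorCircuit_eq_fiveGate] at hXf
  obtain ⟨r₁, T₂, hr1, hr2, hsT, hτ, hcr₁, ha1, hbT, hcT2, hpin7, hd2, hpair, haT⟩ :=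
    knob_dud_second_transfer hX h0 hC hK hε hεK hρ hlo hhi k hk
  have hr₁0 : 0 ≤ r₁ := by linarith [Real.sqrt_nonneg (2 - 24 * Real.log K / K ^ 10)]
  have hT0 : 0 ≤ T₂ := by linarith only [hr₁0, hsT]
  -- the cold window: §131 at `θ = 1/4`
  have hcold : ∀ t ∈ Icc T₂ (T₂ + 1 / 2), X t 2 < ρ ^ 2 / K ^ 9 := by
    have h := knob_cold_of_doused_clock hX h0 hK hε hρ hT0 (θ := 1 / 4) (by norm_num)
      (by linarith only [hbT]) hcT2
    intro t ht
    exact h t ⟨ht.1, by linarith only [ht.2]⟩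
  have hc' : ∀ r ∈ Icc T₂ (T₂ + 1 / 2), X r 2 ≤ ρ ^ 2 / K ^ 9 := fun r hr => (hcold r hr).le
  have hu1 : ρ ^ 2 / K ^ 9 / ρ ^ 2 = 1 / K ^ 9 := by field_simp
  have hK9 : 0 < 1 / K ^ 9 := by positivity
  have hp9 : 1 / K ^ 9 ≤ (1 : ℝ) / 68719476736 := one_div_le_one_div_of_le (by norm_num) h9
  have h242 : (242 : ℝ) / K ^ 9 ≤ 242 / 68719476736 :=
    div_le_div_of_nonneg_left (by norm_num) (by norm_num) h9
  refine ⟨r₁, T₂, hr1, hr2, hsT, hτ, hcr₁, ha1, hbT, hcT2, hpin7, hd2, hpair, haT, ?_, ?_⟩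
  · intro t ht
    have ht0 : 0 ≤ t := hT0.trans ht.1
    -- the frozen output pair
    have hfr := knob_output_frozen hX h0 hρ hT0 hc' t ht
    rw [hu1] at hfr
    have hpt : X t 3 ^ 2 + X t 4 ^ 2 ≤ 1 / 40 + 1 / K ^ 9 := by
      have h1 : 1 / K ^ 9 * (t - T₂) ≤ 1 / K ^ 9 * 1 :=
        mul_le_mul_of_nonneg_left (by linarith only [ht.2]) hK9.le
      linarith only [(le_abs_self _).trans hfr, h1, hpair]
    -- the energy identity: `b(t)² + c(t)² ≤ 10⁻⁵`
    have hE : X t 0 ^ 2 + X t 1 ^ 2 + X t 2 ^ 2 + X t 3 ^ 2 + X t 4 ^ 2 = 1 := by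
      simpa [energy, Fin.sum_univ_five] using energy_init hXf h0 t
    have hbc : X t 1 ^ 2 + X t 2 ^ 2 ≤ 1 / 10 ^ 5 := by
      have hb := abs_b_le hXf h0 hε.le (by positivity) ht0
      have hσ1 : ρ ^ 2 * exp (-K ^ 10) ≤ ε := by
        have : ε * (1 / K ^ 10) ≤ ε * 1 :=
          mul_le_mul_of_nonneg_left (by linarith only [hq1]) hε.le
        linarith only [hσ, this]
      have ht5 : t ≤ 5 := by linarith only [ht.2, hτ, hr2, hsq2, h242]
      have hb10 : |X t 1| ≤ 10 * ε := by
        have : (ε + ρ ^ 2 * exp (-K ^ 10)) * t ≤ (2 * ε) * 5 :=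
          mul_le_mul (by linarith only [hσ1]) ht5 ht0 (by positivity)
        linarith only [hb, this]
      have hb100 : X t 1 ^ 2 ≤ (10 * ε) ^ 2 := by
        have h := pow_le_pow_left₀ (abs_nonneg _) hb10 2; rwa [sq_abs] at h
      have hc0 : 0 ≤ X t 2 := c_nonneg hXf h0 (by positivity) ht0
      have hc1 : X t 2 ≤ ε := by
        have h1 : ρ ^ 2 * (1 / K ^ 9) ≤ ρ ^ 2 * 1 :=
          mul_le_mul_of_nonneg_left (by linarith only [hp9]) hρ2.le
        linarith only [hcold t ht, h1, hρε, show ρ ^ 2 / K ^ 9 = ρ ^ 2 * (1 / K ^ 9) by ring]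
      have hc1' : X t 2 ^ 2 ≤ ε ^ 2 := pow_le_pow_left₀ hc0 hc1 2
      have hK20 : ε ^ 2 ≤ 1 / (6 * (1099511627776 * 1099511627776)) := by
        have : (1099511627776 : ℝ) * 1099511627776 ≤ K ^ 20 := by
          rw [show K ^ 20 = K ^ 10 * K ^ 10 by ring]
          exact mul_le_mul h10 h10 (by norm_num) hK10.le
        exact hεK.trans
          (div_le_div_of_nonneg_left (by norm_num) (by positivity) (by linarith only [this]))
      linarith only [hb100, hc1', hK20]
    exact ⟨hcold t ht, hpt, by linarith only [hE, hpt, hbc, hp9]⟩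
  · intro t ht hTt
    have h := knob_drain_empties_transfer hX h0 hK0 hρ hT0 (by positivity) hc' ht hTt
    rw [hu1] at h
    linarith only [h.1]

end Summit.NavierStokesRegularity.FluidComputer.GateBudget
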